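import Summits.QuantumFields.YangMills.Theorems.UnitScaleTiltProp7QkPenaltyKernelRow
import Summits.QuantumFields.YangMills.Theorems.UnitScaleTiltProp7QTwSColumnBound
import HarnessLib

/-!
# Route `UnitScaleTilt`, crux K1 «MinimiserStabilityRegPr» (stmt-QuantumFields-19200), EX face S47 — (L3′b), ONE-FORM STOREY — **THE DECAYED KERNEL ROW `hk_Q` OF THE AVERAGING
# PENALTY, UNCONDITIONAL AT A PRINTED-REGULAR BACKGROUND**: ✓p766516 `Prop7QkPenaltyKernelRow.hkQ_of_col` with its one displayed letter (COL) DISCHARGED by px13 g15's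
# ✓p766779 `Prop7QTwSColumnBound.col_of_regPr` (`C_Q ≤ 5`, ✓`col_const_le_five`) — the `hkQ` binder of ✓`Prop7OneFormPointwiseDecayE2E.pointwiseDecay_oneForm_DeltaEtaSlot` ∕ O4e,
# with `Ck_Q = 2·a·5²·(cB∕c₀)·ℓ⁻⁶·e^{μ′}` (`= 50a₀e^{μ′}·ℓ⁻³` at the pins), K-FREE (width seat `ym3-torus-px21` gen 14; px17 g10 08:23:01Z «your APPEND, 3 lines»)

Cell `ym3-torus` (HUMAN RULING D-0037; rung R3 = SU(2) YM₃ on T³ — NOT d = 4, NOT infinite volume, NOT a mass gap, NOT Clay).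
THEOREMS ONLY (0 `def`, 0 `sorry`, default heartbeats); `--supports stmt-QuantumFields-19200 --as helper`; count-neutral.  A sibling file (not an append) so that the landed
✓`…QkPenaltyKernelRow` keeps its imports.

WHAT IS PROVED (ns `Summit.QuantumFields.YangMills.Theorems.Prop7QkPenaltyKernelRowOfRegPr`).
* ★★★ `hkQ_of_regPr` — `RegPr F n K ε₀ U₀`, `10¹⁰L⁶ε₀ ≤ 1`, `10¹²L³ε₀ ≤ 1`, `0 ≤ a`, `0 ≤ μ′`: for every `b Z bd`,
  `‖toL2⁻¹(Q_k(U₀)†(a • Q_k(U₀)(toL2(δ_b ⊗ Z))))(bd)‖ ≤ (2·a·5²·(cB∕c₀)·ℓ⁻⁶·e^{μ′})·e^{−μ′·tdist(B b₋, B bd₋)}·‖Z‖` — NO displayed letter.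
HYP-SAT (★★OWNER RULING №42): `RegPr` + routeR-w4's two windows (inhabited on the literal families); nothing eventual; no hypothesis restates a conclusion.
HONEST SCOPE.  A 3-line composition; nothing of O4e's knit, the ten EX rows, `hT`, EX or the crux is proved here; the Yang–Mills mass gap is NOT proved.

References: T. Bałaban, CMP **99** (1985) 389–434 [Balaban1985BackgroundPropagators] ((3.13)–(3.16) p.393, (3.49) p.399); CMP **95** (1984) 17–40 [Balaban1984PropagatorsI] ((1.18) p.20).
-/

set_option autoImplicit false

noncomputable section

open scoped BigOperators Matrix.Norms.L2Operator InnerProductSpace ComplexConjugate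

namespace Summit.QuantumFields.YangMills.Theorems.Prop7QkPenaltyKernelRowOfRegPr

open Literature.MathematicalPhysics.QuantumFieldTheory.Balaban1983to89
open Literature.MathematicalPhysics.QuantumFieldTheory.Balaban1983to89.T3ContinuumYM3Torus
open T3PrintedRegularMinimiser (RegPr)
open B11Eq103H1Complex (BondL2K)
open B5Eq118OneStroke (iterBlockOf)
open Summit.QuantumFields.YangMills.Theorems.Prop7SectET3Transport (periodsT3)
open Summit.QuantumFields.YangMills.Theorems.Prop7SectET3HilbertLetters (W₂ toL2)
open Summit.QuantumFields.YangMills.Theorems.Prop7SectET3CurvedPropagators (Qk)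
open Summit.QuantumFields.YangMills.Theorems.Prop7QkPenaltyKernelRow (hkQ_of_col)
open Summit.QuantumFields.YangMills.Theorems.Prop7QTwSColumnBound (col_of_regPr col_const_le_five)

variable (F : T3Family) {n K : ℕ} (h : n ≤ K) (c₀ cB : ℝ) [Fact (0 < c₀)] [Fact (0 < cB)]

/-- ★★★ **THE DECAYED KERNEL ROW OF `a·Q_k†Q_k`, NO LETTER**: `RegPr F n K ε₀ U₀` with routeR-w4's windows, `0 ≤ a`, `0 ≤ μ′` ⟹ for every `b Z bd`,
`‖toL2⁻¹(Q_k(U₀)†(a • Q_k(U₀)(toL2(δ_b ⊗ Z))))(bd)‖ ≤ (2·a·5²·(cB∕c₀)·ℓ⁻⁶·e^{μ′})·e^{−μ′·tdist(B b₋, B bd₋)}·‖Z‖` — ✓`hkQ_of_col` ∘ px13 ✓`col_of_regPr`, the (COL) constant majorised by `5`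
(✓`col_const_le_five`). [cite: Balaban1985BackgroundPropagators, (3.13)–(3.16) p.393, Thm 3.1 (3.42) p.397, (3.49) p.399; Balaban1984PropagatorsI, (1.18) p.20] -/
theorem hkQ_of_regPr {ε₀ : ℝ} (hε₀ : 0 < ε₀) (hε : 10 ^ 10 * (F.L : ℝ) ^ 6 * ε₀ ≤ 1) (hε12 : 10 ^ 12 * (F.L : ℝ) ^ 3 * ε₀ ≤ 1)
    (U₀ : GaugeField (F.P K) 0 (Matrix.specialUnitaryGroup (Fin 2) ℂ)) (hreg : RegPr F n K ε₀ U₀) {a : ℝ} (ha : 0 ≤ a) {μ' : ℝ} (hμ' : 0 ≤ μ') :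
    ∀ (b : PBond (F.P K) 0) (Z : Matrix (Fin 2) (Fin 2) ℂ) (bd : PBond (F.P K) 0),
      ‖(toL2 F K c₀).symm (LinearMap.adjoint (Qk F n K h c₀ cB U₀) (((a : ℝ) : ℂ) • Qk F n K h c₀ cB U₀ (toL2 F K c₀ (Pi.single b Z)))) bd‖
        ≤ (2 * a * 5 ^ 2 * (cB / c₀) * ((F.L : ℝ) ^ (K - n))⁻¹ ^ 6 * Real.exp μ')
          * Real.exp (-(μ' * (Site.tdist (P := F.P K) (iterBlockOf (K - n) b.src) (iterBlockOf (K - n) bd.src) : ℝ))) * ‖Z‖ := by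
  intro b Z bd
  have hc₀ : 0 < c₀ := Fact.out
  have hcB : 0 < cB := Fact.out
  have hL0 : (0 : ℝ) < F.L := by exact_mod_cast lt_trans zero_lt_one F.hL.2
  -- the (COL) constant and its bound by `5`
  set CQ : ℝ := Real.sqrt 2 * (2 * Real.exp ((159 * ((((F.P K).d + 2) * (F.P K).L : ℕ) : ℝ) * (2 * ((F.P K).d : ℝ)))
              / ((((F.P K).L : ℝ) ^ (F.P K).d)⁻¹ * ((F.P K).L : ℝ)) * (((((F.P K).d + 2) * (F.P K).L : ℕ) : ℝ) ^ 2 / 16 * ε₀)) + 1) with hCQ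
  have hCQ0 : 0 ≤ CQ := by rw [hCQ]; positivity
  have hCQ5 : CQ ≤ 5 := by rw [hCQ]; exact col_const_le_five F (K := K) hε₀ hε
  have hrow := hkQ_of_col F h c₀ cB hε₀ hε12 U₀ hreg ha hμ' hCQ0 (col_of_regPr F h hε₀ hε hε12 U₀ hreg) b Z bd
  refine hrow.trans (mul_le_mul_of_nonneg_right (mul_le_mul_of_nonneg_right ?_ (Real.exp_pos _).le) (norm_nonneg _))
  have h5 : CQ ^ 2 ≤ 5 ^ 2 := pow_le_pow_left₀ hCQ0 hCQ5 2
  have hrest : 0 ≤ (cB / c₀) * ((F.L : ℝ) ^ (K - n))⁻¹ ^ 6 * Real.exp μ' := by positivity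
  nlinarith [mul_le_mul_of_nonneg_right h5 hrest, ha, mul_nonneg ha (mul_nonneg (sq_nonneg CQ) hrest)]

end Summit.QuantumFields.YangMills.Theorems.Prop7QkPenaltyKernelRowOfRegPr

end
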